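import Literature.MathematicalPhysics.QuantumFieldTheory.Balaban1983to89.B15Ineq137Local

/-!
# `Balaban1983to89.B7GaugeFixingLocal` — T. Bałaban, *Averaging operations for lattice gauge theories*, Commun. Math.
# Phys. **98** (1985) 17–51 [Balaban1985Averaging], Sect. C (76)–(77), (87) pp. 29–31 and Sect. F (166) p. 44: the gauge
# fixing `u` of a small field `U₁ = e^{B}` at a general regular background, RESTRICTED TO A `k`-BLOCK `B^k(z)`, is within
# `40d·Lᵏ·sup_{B^k(z)}|B|` of `1` — the bound (166) at `j = 0` of `B7Eq167General` with the supremum LOCALISED to the block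
# (`B7GaugeFixingLocal`)

statement-level skeleton of published theorems with citation tags; proofs where landed; nothing here is a claim
about the Yang–Mills mass gap

WHAT IS REPRODUCED.  A locality rider to SKELETON row **B7.Eq165** (rows of record `lit-balaban-r04/ROWS-B7.md`; the
class-membership sentence p. 43 «they satisfy other conditions following from (107), (108) if the configuration U₁ is
small», @gen PROVED by this seat's `B7Eq167General` (p254173) with a GLOBAL supremum of the exponent field), for the
mega-formalization `lit-balaban` (HOME `run/shared/lean/pub/lit-balaban/`), Phase-2 proof seat `p29` gen 6.  Print
determines `u` block by block (p. 31: *"the gauge transformation is uniquely determined by all the conditions and is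
given by the formulas (77) for j = k − 1 and by (87)"*), so `u` on `B^k(z)` depends on `U₁` only through `U₁↾B^k(z)` —
kernel-checked in `B15Ineq137Local.glev_congr`; this file draws the consequence for the bound (166) at `j = 0`:
* `glev_expCfg_clamp` — on the sites of `B^k(z)` (every level function `u_j` on the sites of the `(k − j)`-block of `z`),
  `glev(U₀, e^{B}) = glev(U₀, e^{B∘π})`, `π` the retraction onto the box `B^k(z) = [Lᵏz, Lᵏz + (Lᵏ − 1)𝟙]`;
* `norm_glev_sub_one_le_local` — in the regime of `B7Eq167General` (Prop. 2 regularity of `U₀ ∈ G`, `G ⊂ U1`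
  averaging-closed; the three smallness conditions for `x = Lᵏb`), if `|B| ≤ b` on the bonds issuing from the sites of
  `B^k(z)` ONLY, then `|u(x) − 1| ≤ 40d·Lᵏb` for every site `x` of `B^k(z)` — the located form in which the gauge
  transformations `u_{j,□}`, `u_{h,□}`, `u_{k+1,□′}` of [Balaban1988Convergent] (3.6)/(3.17) and [Balaban1989LargeFieldI]
  (1.30)/(1.90) are controlled by bounds on `ℍ` «on □̃» only.
MODEL / DECLARED DEVIATIONS: as `B7Eq167General` ((a)–(e) there); the block is read as its set of sites and «the bonds of
the block» as all bonds issuing from its sites (one layer more than the bonds with both ends inside; either reading of the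
printed locality follows).  Net new unproved facts: 0 (no `def`).
-/

noncomputable section

open NormedSpace

namespace Literature.MathematicalPhysics.QuantumFieldTheory.Balaban1983to89.B7GaugeFixingLocal

open B7Prop1Explicit B7Prop2Explicit B7Prop3Flat B7Prop1Local
open B15Ineq137Local (glev_congr)

-- `Site` alone could resolve to the torus sites of `Setup.lean` through a parent namespace; re-export the `ℤ^d`
-- sites of `B7Prop1Explicit`.
export B7Prop1Explicit (Site)

variable {d : ℕ}
variable {𝔸 : Type*} [NormedRing 𝔸] [NormedAlgebra ℂ 𝔸] [CompleteSpace 𝔸] [NormOneClass 𝔸]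

omit [NormOneClass 𝔸] in
/-- **The gauge fixing of `e^{B}` on a `k`-block sees only `B↾B^k(z)`** ((76)–(77), (87): `B15Ineq137Local.glev_congr`): for
`j + m = k` and every site `x_j` of the `m`-block of `z` (level-`j` coordinates), the level-`j` function of `glev(U₀, e^{B})` at
`x_j` equals that of `glev(U₀, e^{B∘π})`, `π` the retraction onto `B^k(z) = [Lᵏz, Lᵏz + (Lᵏ − 1)𝟙]`; `m = k`, `j = 0` is the
gauge transformation itself on the sites of `B^k(z)`. [cite: Balaban1985Averaging, (76)–(77) p.29–30, (87) p.31] -/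
theorem glev_expCfg_clamp {L : ℕ} (hL : 1 ≤ L) (U₀ : Site d → Fin d → 𝔸ˣ) (B : Site d → Fin d → 𝔸) (z : Site d)
    (k m j : ℕ) (hjk : j + m = k) (x : Site d)
    (hx : InBox (loK L m z) (fun i => loK L m z i + ((L : ℤ) ^ m - 1)) x) :
    B7Eq84Concrete.glev L hL U₀ (expCfg B) k j x
      = B7Eq84Concrete.glev L hL U₀
          (expCfg (fun y μ => B (clamp (loK L k z) (fun i => loK L k z i + ((L : ℤ) ^ k - 1)) y) μ)) k j x :=
  glev_congr hL U₀ z k (fun y μ hy _ => by simp only [expCfg, clamp_of_inBox hy]) m j x hjk hx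

/-- **(166) at `j = 0` WITH THE SUPREMUM LOCALISED TO THE BLOCK** — in the regime of `B7Eq167General` (background `U₀`
with values in an averaging-closed `G ⊂ U1`, Prop. 2's `0 < α₀`, `C₀α₀ ≤ ⅓`, `4α₀ ≤ c₂′`, `sup_p|U₀(∂p) − 1| < α₀L^{−2k}`;
the smallness conditions for `x = Lᵏb`): if the exponent field satisfies `|B| ≤ b` on the bonds issuing from the sites of the
block `B^k(z)` only, then the gauge fixing `u = glev(U₀, e^{B})` (the solution of (67) + (81)) obeys `|u(x) − 1| ≤ 40d·Lᵏb`
at every site `x` of `B^k(z)` (`glev_expCfg_clamp` + `B7Eq167General.norm_glev_sub_one_le` for the clamped field, which is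
bounded by `b` everywhere). [cite: Balaban1985Averaging, (166) p.44, p.43 (Sect. F, paragraph after (165)), (87) p.31] -/
theorem norm_glev_sub_one_le_local {L : ℕ} (hL : 2 ≤ L) {G : Subgroup 𝔸ˣ} (hG : AvgClosed d L G) {k : ℕ}
    {U₀ : Site d → Fin d → 𝔸ˣ} (hU₀ : ∀ x κ, U₀ x κ ∈ G) {α₀ : ℝ} (hα : 0 < α₀) (hα3 : C0 d * α₀ ≤ 1 / 3)
    (hα4 : 4 * α₀ ≤ c2' d L) (h52 : pdev U₀ < α₀ * (((L : ℝ) ^ k)⁻¹) ^ 2)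
    {B : Site d → Fin d → 𝔸} (z : Site d) {b : ℝ} (hb : 0 ≤ b)
    (hB : ∀ y μ, InBox (loK L k z) (fun i => loK L k z i + ((L : ℤ) ^ k - 1)) y → ‖B y μ‖ ≤ b)
    (hsmall : Real.exp (4 * (800 * ((d : ℝ) + 1) ^ 2 * ((d : ℝ) + 4)) * α₀)
      * (1 + 8 * (131072 * ((d : ℝ) + 1) ^ 2) * ((L : ℝ) ^ k * b)) ≤ 2)
    (hc₃ : 2 * ((L : ℝ) ^ k * b) ≤ c3 d L) (hs : 128 * (d : ℝ) * ((L : ℝ) ^ k * b) ≤ 1) (hL1 : 1 ≤ L)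
    (x : Site d) (hx : InBox (loK L k z) (fun i => loK L k z i + ((L : ℤ) ^ k - 1)) x) :
    ‖((B7Eq84Concrete.glev L hL1 U₀ (expCfg B) k 0 x : 𝔸ˣ) : 𝔸) - 1‖ ≤ 40 * d * ((L : ℝ) ^ k * b) := by
  have hLk : (1 : ℤ) ≤ (L : ℤ) ^ k := one_le_pow₀ (by exact_mod_cast hL1)
  have hlohi : ∀ i, loK L k z i ≤ loK L k z i + ((L : ℤ) ^ k - 1) := fun i => by linarith
  -- the clamped field is bounded by `b` everywhere
  have hB' : ∀ y μ, ‖B (clamp (loK L k z) (fun i => loK L k z i + ((L : ℤ) ^ k - 1)) y) μ‖ ≤ b :=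
    fun y μ => hB _ μ (clamp_inBox hlohi y)
  rw [glev_expCfg_clamp hL1 U₀ B z k k 0 (by omega) x hx]
  exact B7Eq167General.norm_glev_sub_one_le hL hG hU₀ hα hα3 hα4 h52 hb hB' hsmall hc₃ hs hL1 x

end Literature.MathematicalPhysics.QuantumFieldTheory.Balaban1983to89.B7GaugeFixingLocal

end
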